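import Summits.QuantumFields.YangMills.Theorems.FluctuationComparisonRegPrIntLHeightwiseMainTermOfMembership
import Summits.QuantumFields.YangMills.Theorems.AlphaInputsT3ACv4CoreRows
import Literature.MathematicalPhysics.QuantumFieldTheory.Balaban1983to89.T3ThresholdSmallness
import HarnessLib

/-!
# `FluctuationComparisonRegPrIntLHeightwiseMainTermRows` — ⟨MAIN-H⟩ AT ROWS GENERALITY: the heightwise main-term row of the UP∘∕LOWB∘ chain for the
# VERSION-AGNOSTIC rows record `AlphaInputsT3AC.PkgCoreRows F 𝔠 γ hγ hγ1 K` (★★OWNER RULING g26-№14 (F-2b) «generalise once»), hence for the v4 χ-package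
# `AlphaInputsT3AC.OfV4ChiAt` (the socket the supply chain of record feeds, px8 g15's (C) CENSUS 54fa6dcb) AND for the v3 package (recovered by `.toCore.toRows`)
# (crux `FluctuationComparisonRegPrIntL`, stmt-QuantumFields-20520)

Cell `ym3-torus` (YM ladder rung R3 = continuum SU(2) Yang–Mills on T³ — a RUNG, NOT d = 4, NOT infinite volume, NOT a mass gap, NOT Clay);
width seat `ym-ust-20520-w4` (gen 18), explicit-unit helper; `--supports stmt-QuantumFields-20520 --as helper`; px8 g15 09:47:18Z ‼ CURRENCY FLAG, §4 «(O-LOW-ROWS)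
w4∕LEAD: `hMainH` twin over `PkgCoreRows`».  THEOREMS ONLY (0 `def`, 0 `sorry`, default heartbeats).  Nothing landed is touched: ✓`…HeightwiseMainTermOfMembership`
(p767771) keeps `hMainH_v3`; this file is its strict generalisation.

WHAT.  ✓`hMainH_v3` closed the heightwise main-term row
`∀ n, ∃ Cm, ∀ K (hK : n ≤ K) (W : GaugeField (F.P K) (K − n) SU(2)), PlaqSmall (θBal F.L γ 𝔠.b₀ 𝔠.p₀ n) W → T.mainT (K − n) (T.triv (K − n)) W ≤ Cm`
for the tower `T` of the VERSION-3 package `h.pkgAtV3 hc γ hγ hγ1 K`, from TWO API rows of that package — `mainT_eq` (`mainT_j(h, W) = β_K·A₄(U_j(h, W))`) and the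
minimiser row r1 `uminTriv_mem_regFibrePr` ([Balaban1985Variational] Thm 1 (8): `U_{K−n}(triv, V) ∈ regFibrePr F n K _ ε₀ V` for `PlaqSmall ε₁ V`, `0 < ε₁ ≤ a₁`,
`B₃ε₁ ≤ ε₀ ≤ a₀`) — plus `hU0` (`U_0(triv, W) = W`) and §1∕§4 arithmetic of the parent file ((11) p.258: `β_K·A(U) ≤ 12·ε₀²·L^{3m+4n}∕γ` on the regular fibre).
The SAME two rows, with the SAME texts, are fields∕theorems of the version-agnostic rows record ✓`AlphaInputsT3AC.PkgCoreRows` (`PkgCoreRows.mainT_eq`,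
`PkgCoreRows.uminTriv_mem_regFibrePr`, `PkgCoreRows.hU0`), which BOTH the v3 core (`PkgAtV3.toCore`, `PkgCoreV3.toRows`) and the v4 χ-package (`PkgAtV4Chi.toRows`) feed.
So the row holds for ANY family of rows records `q : ∀ K, PkgCoreRows F 𝔠 γ hγ hγ1 K`:
* §1 ★★★★ `hMainH_rows` — for `q : ∀ K, AlphaInputsT3AC.PkgCoreRows F 𝔠 γ hγ hγ1 K` and the two γ-window letters asked PER RUN, `θBal(n) ≤ (q K).a₁` and
  `B₃·θBal(n) ≤ (q K).a₀` (the records' Thm-1 constants may vary with `K`; only the letters are read), ONE `K`-FREE constant per height,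
  `Cm := 12·((B₃θBal(n))² + θBal(n)²)·L^{3m+4n}∕γ`, bounds `(q K).T.mainT (K − n) ((q K).T.triv (K − n)) W` over every `θBal(n)`-small height-`n` datum `W`, every `K ≥ n`
  (`n < K`: r1 at `ε₁ := θBal(n)`, `ε₀ := B₃θBal(n)` ∘ parent §1; `K = n`: `hU0` ∘ parent §4's first lemma).
* §2 ★★ `hMainH_v4Chi` — the row for the v4 χ-PACKAGE `h : AlphaInputsT3AC.OfV4ChiAt F 𝔠 a₀ a₁` in the χ-road's own letters `(h.pkgAtV4Chi hc γ hγ hγ1 K).toRows.T`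
  (cf. ✓`AlphaInputsT3ACv4ChiInt.le_resDensity_int_ae`, which asks the same smallness letter `θBal(i) ≤ a₁`), under the two letters `θBal(n) ≤ a₁`, `B₃θBal(n) ≤ a₀`
  (`pkgAtV4Chi_a₀∕_a₁`); and an `example` re-deriving ✓`hMainH_v3`'s statement for the v3 package through `(h.pkgAtV3 hc γ hγ hγ1 K).toCore.toRows` (the towers agree
  definitionally) — the rows edition subsumes the v3 edition.
* §3 ★ `exists_coupling_window_letters` — BOTH window letters at once for `γ ≤ γ₁(L, b₀, p₀, B₃, a₀, a₁)` (lit ✓`T3ThresholdSmallness.exists_forall_θBal_le` at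
  `ε := min a₁ (a₀∕B₃)`); ★★ `hMainH_v4Chi_of_small_coupling` — §2 with the letters FOLDED: `∃ γ₁ > 0, ∀ γ ≤ γ₁` in the (α)-window, the row holds for the χ-package at `γ`.

HONEST SCOPE.  A mechanical port of ✓`hMainH_v3` to the rows record (no new mathematics): bookkeeping over `PkgCoreRows.mainT_eq` ∕ r1 ∕ `hU0` and the parent file's
arithmetic; the (α) rows and the minimiser rows are the UV3 node's HYPOTHESIS SCHEMA (OPEN in every socket version — fields of the record, displayed, NOT proved);
nothing of Thm 1 (5), UP∘, LOWB∘, PERS₁∘, TUBE∘, S2β, the crux 20520, EX∕19200, 19936, or any rung statement is proved; `YM3TorusSU2` NOT proved; the Yang–Mills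
mass gap (Clay) NOT proved.

References: T. Bałaban, Commun. Math. Phys. **102** (1985) 255–275 [Balaban1985UV3] ((5) p.256, (7) p.257, (11) p.258, (41)–(42) p.266, Thm 2 p.272, (71) p.273);
T. Bałaban, CMP **102** (1985) 277–309 [Balaban1985Variational] ((6) p.278, Thm 1 (8) p.279).
-/

set_option autoImplicit false

noncomputable section

namespace Summit.QuantumFields.YangMills.Theorems.FluctuationComparisonRegPrIntLHeightwiseMainTermRows

open MeasureTheory
open Literature.MathematicalPhysics.QuantumFieldTheory.Balaban1983to89
open Literature.MathematicalPhysics.QuantumFieldTheory.Balaban1983to89.T3ContinuumYM3Torus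
open Literature.MathematicalPhysics.QuantumFieldTheory.Balaban1983to89.T3UnitLawDensityEML (ℰp)
open Literature.MathematicalPhysics.QuantumFieldTheory.Balaban1983to89.T3UnitScaleTilt (θBal)
open Literature.MathematicalPhysics.QuantumFieldTheory.Balaban1983to89.T3PrintedRegularMinimiser (regFibrePr)
open Literature.MathematicalPhysics.QuantumFieldTheory.Balaban1983to89.T3RegularMinimiser (regThreshold)
open Literature.MathematicalPhysics.QuantumFieldTheory.Balaban1983to89.T3LevelShift (fieldShift)
open Literature.MathematicalPhysics.QuantumFieldTheory.Balaban1983to89.T3AlphaInputsAC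
open Literature.MathematicalPhysics.QuantumFieldTheory.Balaban1985CMP102
open Literature.MathematicalPhysics.QuantumFieldTheory.Balaban1985CMP102.Setting
open Summit.QuantumFields.Balaban3D.Carriers
open Summit.QuantumFields.Balaban3D.Proofs.Primitives
open Summit.QuantumFields.YangMills.Theorems.FluctuationComparisonRegPrIntLHeightwiseMainTermOfMembership
  (beta_mul_wilsonAction4_le_of_regFibrePr_height beta_mul_wilsonAction4_le_of_plaqSmall_regThreshold)

variable {F : T3Family} {𝔠 : AlphaConsts F.L (suGroupModel 2).N} {γ : ℝ} {hγ : 0 < γ} {hγ1 : γ ≤ (min 𝔠.gamma0 1) ^ 2}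

/-! ## §1 The heightwise main-term row for ANY family of rows records -/

/-- ★★★★ **THE HEIGHTWISE MAIN-TERM ROW AT ROWS GENERALITY** (px8 g15's (O-LOW-ROWS); ✓`hMainH_v3` with `h.pkgAtV3 hc γ hγ hγ1 K ↦ q K`): for ANY family of rows records
`q : ∀ K, AlphaInputsT3AC.PkgCoreRows F 𝔠 γ hγ hγ1 K` and the two γ-WINDOW LETTERS read per run, `θBal(n) ≤ (q K).a₁` and `B₃·θBal(n) ≤ (q K).a₀` (every height `n`,
every `K`; §3 gives both for `γ ≤ γ₁` when the constants do not depend on `K`), for EVERY height `n` ONE `K`-free constant `Cm := 12·((B₃θBal(n))² + θBal(n)²)·L^{3m+4n}∕γ`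
bounds the record's trivial-history main term `mainT_{K−n}(triv, W)` over every `θBal(n)`-small height-`n` datum `W`, for EVERY run `K ≥ n`:
`n < K` — the minimiser row r1 ✓`PkgCoreRows.uminTriv_mem_regFibrePr` at `ε₁ := θBal(n)`, `ε₀ := B₃θBal(n)` (datum `V := W` relabelled by lit `fieldShift`, plaquettes
preserved, lit ✓`T3CruxEstimates.plaqSmall_fieldShift`) puts `U_{K−n}(triv, W)` in `regFibrePr F n K _ (B₃θBal(n)) V`, and the parent's §1 bounds its action by
`12·(B₃θBal(n))²·L^{3m+4n}∕γ`; `K = n` — `U_0(triv, W) = W` (`hU0`) and the datum's own smallness (`regThreshold F n n θ = θ`) give `12·θBal(n)²·L^{3m+4n}∕γ`.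
NO displayed row beyond the rows records and the two window letters. [cite: Balaban1985Variational, Thm 1 (8) p.279, (6) p.278; Balaban1985UV3, (5) p.256, (11) p.258, (41)-(42) p.266] -/
theorem hMainH_rows (q : ∀ K : ℕ, AlphaInputsT3AC.PkgCoreRows F 𝔠 γ hγ hγ1 K)
    (hθ₁ : ∀ n K : ℕ, θBal F.L γ 𝔠.b₀ 𝔠.p₀ n ≤ (q K).a₁) (hθ₀ : ∀ n K : ℕ, 𝔠.B₃ * θBal F.L γ 𝔠.b₀ 𝔠.p₀ n ≤ (q K).a₀) :
    ∀ n : ℕ, ∃ Cm : ℝ, ∀ (K : ℕ) (hK : n ≤ K) (W : GaugeField (F.P K) (K - n) (Matrix.specialUnitaryGroup (Fin 2) ℂ)),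
      PlaqSmall (θBal F.L γ 𝔠.b₀ 𝔠.p₀ n) W → (q K).T.mainT (K - n) ((q K).T.triv (K - n)) W ≤ Cm := by
  intro n
  have hL1 : 1 ≤ F.L := F.hL.2.le
  have hγ1' : γ ≤ 1 := hγ1.trans (sq_min_one_le _ 𝔠.gamma0_pos)
  set θ := θBal F.L γ 𝔠.b₀ 𝔠.p₀ n with hθ
  have hθpos : 0 < θ := T3MinimiserStabilityReduction.θBal_pos hL1 hγ hγ1' 𝔠.b₀_pos 𝔠.p₀ n
  refine ⟨12 * ((𝔠.B₃ * θ) ^ 2 + θ ^ 2) * (F.L : ℝ) ^ (3 * F.m + 4 * n) / γ, fun K hK W hW => ?_⟩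
  have hmono : ∀ {x : ℝ}, x ^ 2 ≤ (𝔠.B₃ * θ) ^ 2 + θ ^ 2 → 12 * x ^ 2 * (F.L : ℝ) ^ (3 * F.m + 4 * n) / γ ≤
      12 * ((𝔠.B₃ * θ) ^ 2 + θ ^ 2) * (F.L : ℝ) ^ (3 * F.m + 4 * n) / γ := fun hx => by
    have hL0 : (0 : ℝ) ≤ (F.L : ℝ) ^ (3 * F.m + 4 * n) := by positivity
    exact div_le_div_of_nonneg_right (by nlinarith [hL0]) hγ.le
  rw [(q K).mainT_eq (K - n) ((q K).T.triv (K - n)) W]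
  rcases hK.eq_or_lt with rfl | hnK
  · -- `K = n`: the composite minimiser of the trivial history at level `0 = n − n` is the datum itself (`hU0`)
    have hth : regThreshold F n n θ = θ := by
      show θ * ((F.L : ℝ)⁻¹) ^ (2 * (n - n)) = θ
      rw [Nat.sub_self, Nat.mul_zero, pow_zero, mul_one]
    have key : ∀ (j : ℕ), j = 0 → ∀ W' : GaugeField (F.P n) j (Matrix.specialUnitaryGroup (Fin 2) ℂ),
        PlaqSmall θ W' → PlaqSmall θ ((q n).UkH j ((q n).T.triv j) W') := by
      intro j hj W' hW'
      subst hj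
      rw [show (q n).UkH 0 ((q n).T.triv 0) W' = W' from (q n).hU0 W']
      exact hW'
    have hW' : PlaqSmall (regThreshold F n n θ) ((q n).UkH (n - n) ((q n).T.triv (n - n)) W) := by
      rw [hth]
      exact key (n - n) (Nat.sub_self n) W hW
    exact (beta_mul_wilsonAction4_le_of_plaqSmall_regThreshold F hγ θ le_rfl hW').trans
      (hmono (le_add_of_nonneg_left (sq_nonneg _)))
  · -- `n < K`: the minimiser row r1 puts `U_{K−n}(triv, W)` in print's regular fibre (radius `B₃θ`) over the datum `W` read at height `n`
    have hs : (F.PP F.m K).sitesPerDir (K - n) = (F.PP F.m n).sitesPerDir 0 :=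
      F.sitesPerDir_eq (m := F.m) (K := K) (j := K - n) (m' := F.m) (K' := n) (j' := 0) (by omega)
    set V : GaugeField (F.P n) 0 (Matrix.specialUnitaryGroup (Fin 2) ℂ) := fieldShift hs.symm W with hV
    have hVsmall : PlaqSmall θ V := (T3CruxEstimates.plaqSmall_fieldShift F hs.symm θ W).mpr hW
    have hWV : fieldShift hs V = W := T3LevelShift.fieldShift_symm_fieldShift hs W
    have hmem := (q K).uminTriv_mem_regFibrePr hnK hθpos (hθ₁ n K) le_rfl (hθ₀ n K) V hVsmall
    rw [hWV] at hmem
    exact (beta_mul_wilsonAction4_le_of_regFibrePr_height F hγ (𝔠.B₃ * θ) hnK.le V hmem).trans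
      (hmono (le_add_of_nonneg_right (sq_nonneg _)))

/-! ## §2 The v4 χ-package (the socket of record) and the v3 package (recovered) -/

variable {a₀ a₁ : ℝ}

/-- ★★ **THE HEIGHTWISE MAIN-TERM ROW FOR THE v4 χ-PACKAGE** (the socket the supply chain of record feeds — ✓`laneRecordsV4Chi_of_thm1In8_selXsDataRows_allL`), in the χ-road's
own letters `(h.pkgAtV4Chi hc γ hγ hγ1 K).toRows.T` (as read by ✓`AlphaInputsT3ACv4ChiInt.le_resDensity_int_ae`): §1 at `q K := (h.pkgAtV4Chi hc γ hγ hγ1 K).toRows`, the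
per-run letters being the two γ-window letters `θBal(n) ≤ a₁`, `B₃θBal(n) ≤ a₀` through `pkgAtV4Chi_a₁∕_a₀`.
[cite: Balaban1985Variational, Thm 1 (8) p.279; Balaban1985UV3, (5) p.256, (11) p.258, Thm 2 p.272] -/
theorem hMainH_v4Chi (h : AlphaInputsT3AC.OfV4ChiAt F 𝔠 a₀ a₁) (hc : 0 < a₀ ∧ 0 < a₁ ∧ 𝔠.B₃ * a₁ ≤ a₀)
    (γ : ℝ) (hγ : 0 < γ) (hγ1 : γ ≤ (min 𝔠.gamma0 1) ^ 2)
    (hθ₁ : ∀ n : ℕ, θBal F.L γ 𝔠.b₀ 𝔠.p₀ n ≤ a₁) (hθ₀ : ∀ n : ℕ, 𝔠.B₃ * θBal F.L γ 𝔠.b₀ 𝔠.p₀ n ≤ a₀) :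
    ∀ n : ℕ, ∃ Cm : ℝ, ∀ (K : ℕ) (hK : n ≤ K) (W : GaugeField (F.P K) (K - n) (Matrix.specialUnitaryGroup (Fin 2) ℂ)),
      PlaqSmall (θBal F.L γ 𝔠.b₀ 𝔠.p₀ n) W →
        (h.pkgAtV4Chi hc γ hγ hγ1 K).toRows.T.mainT (K - n) ((h.pkgAtV4Chi hc γ hγ hγ1 K).toRows.T.triv (K - n)) W ≤ Cm :=
  hMainH_rows (fun K => (h.pkgAtV4Chi hc γ hγ hγ1 K).toRows)
    (fun n K => (hθ₁ n).trans_eq (h.pkgAtV4Chi_a₁ hc γ hγ hγ1 K).symm)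
    (fun n K => (hθ₀ n).trans_eq (h.pkgAtV4Chi_a₀ hc γ hγ hγ1 K).symm)

/-- (doorfit) ✓`hMainH_v3`'s STATEMENT for the VERSION-3 package, re-derived from §1 through `(h.pkgAtV3 hc γ hγ hγ1 K).toCore.toRows` — the v3 package's tower and the
rows record's tower agree definitionally, so the rows edition subsumes the v3 edition. [cite: Balaban1985Variational, Thm 1 (8) p.279; Balaban1985UV3, (41) p.266] -/
example (h : AlphaInputsT3AC.OfV3At F 𝔠 a₀ a₁) (hc : 0 < a₀ ∧ 0 < a₁ ∧ 𝔠.B₃ * a₁ ≤ a₀)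
    (γ : ℝ) (hγ : 0 < γ) (hγ1 : γ ≤ (min 𝔠.gamma0 1) ^ 2)
    (hθ₁ : ∀ n : ℕ, θBal F.L γ 𝔠.b₀ 𝔠.p₀ n ≤ a₁) (hθ₀ : ∀ n : ℕ, 𝔠.B₃ * θBal F.L γ 𝔠.b₀ 𝔠.p₀ n ≤ a₀) :
    ∀ n : ℕ, ∃ Cm : ℝ, ∀ (K : ℕ) (hK : n ≤ K) (W : GaugeField (F.P K) (K - n) (Matrix.specialUnitaryGroup (Fin 2) ℂ)),
      PlaqSmall (θBal F.L γ 𝔠.b₀ 𝔠.p₀ n) W →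
        (h.pkgAtV3 hc γ hγ hγ1 K).T.mainT (K - n) ((h.pkgAtV3 hc γ hγ hγ1 K).T.triv (K - n)) W ≤ Cm :=
  hMainH_rows (fun K => (h.pkgAtV3 hc γ hγ hγ1 K).toCore.toRows)
    (fun n K => (hθ₁ n).trans_eq (h.pkgAtV3_a₁ hc γ hγ hγ1 K).symm)
    (fun n K => (hθ₀ n).trans_eq (h.pkgAtV3_a₀ hc γ hγ hγ1 K).symm)

/-! ## §3 The two γ-window letters, folded -/

/-- ★ **BOTH γ-WINDOW LETTERS AT ONCE FOR SMALL COUPLING**: for `L ≥ 1`, `B₃ > 0`, `a₀, a₁ > 0` there is `γ₁ > 0` with `θBal L γ b₀ p₀ n ≤ a₁` AND `B₃·θBal L γ b₀ p₀ n ≤ a₀`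
for ALL `0 < γ ≤ γ₁` and ALL heights `n` (lit ✓`exists_forall_θBal_le` at `ε := min a₁ (a₀∕B₃)`). [cite: Balaban1985Variational, Thm 1 p.279] -/
theorem exists_coupling_window_letters {L : ℕ} (hL : 1 ≤ L) (b₀ p₀ : ℝ) {B₃ a₀ a₁ : ℝ} (hB₃ : 0 < B₃) (ha₀ : 0 < a₀) (ha₁ : 0 < a₁) :
    ∃ γ₁ : ℝ, 0 < γ₁ ∧ ∀ γ : ℝ, 0 < γ → γ ≤ γ₁ →
      (∀ n : ℕ, θBal L γ b₀ p₀ n ≤ a₁) ∧ (∀ n : ℕ, B₃ * θBal L γ b₀ p₀ n ≤ a₀) := by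
  obtain ⟨γ₁, hγ₁, hle⟩ := T3ThresholdSmallness.exists_forall_θBal_le hL b₀ p₀ (lt_min ha₁ (div_pos ha₀ hB₃))
  refine ⟨γ₁, hγ₁, fun γ hγ hγle => ⟨fun n => (hle γ hγ hγle n).trans (min_le_left _ _), fun n => ?_⟩⟩
  have h1 : θBal L γ b₀ p₀ n ≤ a₀ / B₃ := (hle γ hγ hγle n).trans (min_le_right _ _)
  calc B₃ * θBal L γ b₀ p₀ n ≤ B₃ * (a₀ / B₃) := mul_le_mul_of_nonneg_left h1 hB₃.le
    _ = a₀ := mul_div_cancel₀ a₀ hB₃.ne'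

/-- ★★ **THE HEIGHTWISE MAIN-TERM ROW FOR THE v4 χ-PACKAGE, WINDOW LETTERS FOLDED**: for `h : AlphaInputsT3AC.OfV4ChiAt F 𝔠 a₀ a₁` (`0 < a₀`, `0 < a₁`, `B₃a₁ ≤ a₀`)
there is `γ₁ > 0` (depending on `L, b₀, p₀, B₃, a₀, a₁` only) such that for EVERY coupling `0 < γ ≤ γ₁` in the (α)-window the row of §2 holds at `γ` with NO further letter.
[cite: Balaban1985Variational, Thm 1 (8) p.279; Balaban1985UV3, (5) p.256, (7) p.257, (11) p.258] -/
theorem hMainH_v4Chi_of_small_coupling (h : AlphaInputsT3AC.OfV4ChiAt F 𝔠 a₀ a₁) (hc : 0 < a₀ ∧ 0 < a₁ ∧ 𝔠.B₃ * a₁ ≤ a₀) :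
    ∃ γ₁ : ℝ, 0 < γ₁ ∧ ∀ (γ : ℝ) (hγ : 0 < γ) (hγ1 : γ ≤ (min 𝔠.gamma0 1) ^ 2), γ ≤ γ₁ →
      ∀ n : ℕ, ∃ Cm : ℝ, ∀ (K : ℕ) (hK : n ≤ K) (W : GaugeField (F.P K) (K - n) (Matrix.specialUnitaryGroup (Fin 2) ℂ)),
        PlaqSmall (θBal F.L γ 𝔠.b₀ 𝔠.p₀ n) W →
          (h.pkgAtV4Chi hc γ hγ hγ1 K).toRows.T.mainT (K - n) ((h.pkgAtV4Chi hc γ hγ hγ1 K).toRows.T.triv (K - n)) W ≤ Cm := by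
  obtain ⟨γ₁, hγ₁, hle⟩ := exists_coupling_window_letters F.hL.2.le 𝔠.b₀ 𝔠.p₀ 𝔠.B₃_pos hc.1 hc.2.1
  exact ⟨γ₁, hγ₁, fun γ hγ hγ1 hγle => hMainH_v4Chi h hc γ hγ hγ1 (hle γ hγ hγle).1 (hle γ hγ hγle).2⟩

end Summit.QuantumFields.YangMills.Theorems.FluctuationComparisonRegPrIntLHeightwiseMainTermRows

end
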